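import Literature.RepresentationTheory.FiniteGroups.InducedInvariantsCharpoly
import HarnessLib

/-!
# The Euler factor of an induced representation: groups acting through a finite quotient

Topic `Literature/RepresentationTheory/FiniteGroups`, namespace `Literature.RepTheory`; continues
`Literature.RepresentationTheory.FiniteGroups.InducedInvariantsCharpoly` (Artin 1931 §2 /
Neukirch VII (10.4) (iv): `det(1 - φt; V^{I}) = ∏ᵢ det(1 - φ'ᵢ t^{fᵢ}; W₀^{I'ᵢ})` for a
representation of a *finite* group induced from `W₀`).  The absolute Galois group `Γ_K` is
not finite and its decomposition groups modulo inertia are `≅ Ẑ`, only *topologically*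
generated by a Frobenius; an Artin representation, however, acts through a finite quotient.
This file performs the reduction:

* `reverse_charpoly_restrict_invariants_eq_prod_of_quotient` (**proved**): the theorem of
  `InducedInvariantsCharpoly` for an arbitrary group `G` and a normal subgroup `N ⊴ G` of
  finite index acting trivially on `V` with `N ≤ H`, the hypothesis "`D = ⋃ₐ φ^a I`" being
  replaced by "every `d ∈ D` lies in `φ^a I N`" (all other hypotheses — double coset
  representatives, Frobenius elements `φ'ᵢ ∈ H ∩ τᵢ⁻¹ φ^{fᵢ} I τᵢ`, minimality of `fᵢ` — are
  the exact ones).  Proof: the data descend to `G ⧸ N` (`QuotientGroup.lift`,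
  `Subgroup.map (QuotientGroup.mk' N)`), the fixed spaces do not change
  (`invariants_comp_map_mk_eq`, `invariants_comp_inf_comap_map_mk_eq` — the latter uses
  `N ≤ H`), and the finite-group theorem applies.
* `mem_of_map_toSubmodule_eq`, `mem_of_apply_eq_one` (**proved**, Serre §3.3): in an induced
  representation with `W₀ ≠ 0` the stabiliser of `W₀` is `H`; in particular `ker ρ ≤ H`, so
  that `N = ker ρ` is admissible above.
* `charpoly_restrict_congr`, `quotientLift_mk`: bookkeeping.

No definition is introduced (theorems only).  Together with
`Literature.RepresentationTheory.FiniteGroups.InducedDimension` (the Serre datum of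
`σ ≃ Representation.ind φ π` and the transport of Euler factors along `A ≅ W₀`) this is the
representation-theoretic input for the named fact `Literature.NumberTheory.GaloisRepresentations.artinLFunction_eq_of_isInducedFrom`
(`Literature.NumberTheory.GaloisRepresentations.ArtinFormalism`); what remains there is
arithmetic: decomposition/inertia groups and Frobenii of `Γ_M` versus `Γ_K` at the primes
above `𝔭`, and the regrouping `∏_𝔭 ∏_{𝔮 ∣ 𝔭} = ∏_𝔮` of the Euler product.

## References

* E. Artin, *Zur Theorie der L-Reihen mit allgemeinen Gruppencharakteren*, Abh. Math. Sem.
  Univ. Hamburg 8 (1931), §2 (`ArtinHamburg1931`).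
* J. Neukirch, *Algebraic Number Theory* (1999), VII §10, Prop. (10.4) (iv) and its proof,
  pp. 522–524 (`NeukirchANT1999`).
* J.-P. Serre, *Linear Representations of Finite Groups*, GTM 42 (1977), §3.3
  (`SerreLinearRepresentations1977`).
-/

namespace Literature.RepresentationTheory.FiniteGroups

/-! ### Groups acting through a finite quotient -/

section Quotient

variable {k : Type*} [Field k] {G : Type*} [Group G]
  {V : Type*} [AddCommGroup V] [Module k V]
  (ρ : Representation k G V)

/-- Restrictions of equal endomorphisms to equal invariant subspaces have the same
characteristic polynomial. [folklore] -/
theorem charpoly_restrict_congr [FiniteDimensional k V] {p q : Submodule k V} (hpq : p = q)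
    {f g : V →ₗ[k] V} (hfg : f = g) (hp : Set.MapsTo f p p) (hq : Set.MapsTo g q q) :
    (f.restrict hp).charpoly = (g.restrict hq).charpoly := by
  subst hpq hfg
  rfl

variable (N : Subgroup G) [N.Normal] (hN : ∀ n ∈ N, ρ n = 1)

/-- The representation of `G ⧸ N` on `V` deduced from `ρ` when `N` acts trivially
(`QuotientGroup.lift`), evaluated at `mk g`. [folklore] -/
theorem quotientLift_mk (g : G) :
    (QuotientGroup.lift N ρ fun n hn => hN n hn : Representation k (G ⧸ N) V)
      (QuotientGroup.mk g) = ρ g := rfl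

/-- Invariants under the image `Ī ≤ G/N` of a subgroup `I ≤ G` are the invariants under `I`.
[folklore] -/
theorem invariants_comp_map_mk_eq (I : Subgroup G) :
    Representation.invariants ((QuotientGroup.lift N ρ fun n hn => hN n hn :
        Representation k (G ⧸ N) V).comp (I.map (QuotientGroup.mk' N)).subtype) =
      Representation.invariants (ρ.comp I.subtype) := by
  ext v
  simp only [Representation.mem_invariants, MonoidHom.coe_comp, Function.comp_apply,
    Subgroup.subtype_apply, Subtype.forall]
  constructor
  · intro h y hy
    exact h (QuotientGroup.mk y) (Subgroup.mem_map_of_mem _ hy)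
  · intro h z hz
    obtain ⟨y, hy, rfl⟩ := Subgroup.mem_map.mp hz
    exact h y hy

/-- Invariants under `H̄ ∩ τ̄⁻¹ Ī τ̄` in `G/N` are the invariants under `H ∩ τ⁻¹ I τ`, provided
`N ≤ H` acts trivially. [folklore] -/
theorem invariants_comp_inf_comap_map_mk_eq (H I : Subgroup G) (hNH : N ≤ H) (τ : G) :
    Representation.invariants ((QuotientGroup.lift N ρ fun n hn => hN n hn :
        Representation k (G ⧸ N) V).comp
        (H.map (QuotientGroup.mk' N) ⊓ (I.map (QuotientGroup.mk' N)).comap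
          (MulAut.conj (QuotientGroup.mk' N τ)).toMonoidHom).subtype) =
      Representation.invariants (ρ.comp (H ⊓ I.comap (MulAut.conj τ).toMonoidHom).subtype) := by
  ext v
  simp only [Representation.mem_invariants, MonoidHom.coe_comp, Function.comp_apply,
    Subgroup.subtype_apply, Subtype.forall]
  constructor
  · intro h z hz
    obtain ⟨hzH, hzI⟩ := Subgroup.mem_inf.mp hz
    rw [Subgroup.mem_comap] at hzI
    have := h (QuotientGroup.mk z) (Subgroup.mem_inf.mpr ⟨Subgroup.mem_map_of_mem _ hzH,
      Subgroup.mem_comap.mpr ?_⟩)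
    · exact this
    · change QuotientGroup.mk' N τ * QuotientGroup.mk z * (QuotientGroup.mk' N τ)⁻¹ ∈ _
      rw [QuotientGroup.mk'_apply, ← QuotientGroup.mk_mul, ← QuotientGroup.mk_inv,
        ← QuotientGroup.mk_mul]
      exact Subgroup.mem_map_of_mem _ hzI
  · intro h z hz
    obtain ⟨hzH, hzI⟩ := Subgroup.mem_inf.mp hz
    obtain ⟨x, hxH, rfl⟩ := Subgroup.mem_map.mp hzH
    rw [Subgroup.mem_comap] at hzI
    change QuotientGroup.mk' N τ * QuotientGroup.mk' N x * (QuotientGroup.mk' N τ)⁻¹ ∈ _ at hzI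
    rw [← map_mul, ← map_inv, ← map_mul] at hzI
    obtain ⟨y, hyI, hy⟩ := Subgroup.mem_map.mp hzI
    -- `n := y⁻¹ τ x τ⁻¹ ∈ N`
    have hn : y⁻¹ * (τ * x * τ⁻¹) ∈ N := by
      rw [← QuotientGroup.eq]; exact hy
    set n := y⁻¹ * (τ * x * τ⁻¹) with hndef
    have hn' : τ⁻¹ * n * τ ∈ N := by
      have := Subgroup.Normal.conj_mem inferInstance n hn τ⁻¹
      simpa using this
    have hz₀ : τ⁻¹ * y * τ ∈ H ⊓ I.comap (MulAut.conj τ).toMonoidHom := by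
      refine Subgroup.mem_inf.mpr ⟨?_, Subgroup.mem_comap.mpr ?_⟩
      · have : τ⁻¹ * y * τ = x * (τ⁻¹ * n * τ)⁻¹ := by rw [hndef]; group
        rw [this]
        exact H.mul_mem hxH (H.inv_mem (hNH hn'))
      · change τ * (τ⁻¹ * y * τ) * τ⁻¹ ∈ I
        rw [show τ * (τ⁻¹ * y * τ) * τ⁻¹ = y by group]
        exact hyI
    have hx : x = (τ⁻¹ * y * τ) * (τ⁻¹ * n * τ) := by rw [hndef]; group
    change ρ x v = v
    rw [hx, map_mul, Module.End.mul_apply, hN _ hn', Module.End.one_apply]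
    exact h _ hz₀

end Quotient

/-! ### The stabiliser of `W₀` -/

section Stabiliser

variable {k : Type*} [Field k] {G : Type*} [Group G]
  {V : Type*} [AddCommGroup V] [Module k V] [FiniteDimensional k V]
  (ρ : Representation k G V) (H : Subgroup G) (W₀ : Subrepresentation (ρ.comp H.subtype))

/-- **The stabiliser of `W₀` in an induced representation is `H`.**  If
`V = ⊕_{c ∈ G/H} ρ(c) W₀` (translates spanning, `dim V = [G:H] dim W₀`) with `W₀ ≠ 0`, and
`ρ(g) W₀ = W₀`, then `g ∈ H` (the blocks `ρ(c) W₀` are independent, Serre §3.3).  In particular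
the kernel of `ρ` lies in `H` (`mem_of_apply_eq_one`), which is what allows to pass to the
finite quotient `G / ker ρ` in `reverse_charpoly_restrict_invariants_eq_prod_of_quotient`.
[cite: SerreLinearRepresentations1977, §3.3] -/
theorem mem_of_map_toSubmodule_eq [H.FiniteIndex]
    (hspan : ⨆ g : G, W₀.toSubmodule.map (ρ g) = ⊤)
    (hdim : Module.finrank k V = H.index * Module.finrank k W₀.toSubmodule)
    (hW₀ : W₀.toSubmodule ≠ ⊥) {g : G} (hg : W₀.toSubmodule.map (ρ g) = W₀.toSubmodule) :
    g ∈ H := by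
  classical
  haveI : Fintype (G ⧸ H) := Fintype.ofFinite _
  by_contra hgH
  set n := Module.finrank k W₀.toSubmodule
  let b : Module.Basis (Fin n) k W₀.toSubmodule := Module.finBasis k W₀.toSubmodule
  obtain ⟨hli, -⟩ := linearIndependent_translate_basis ρ H W₀ hspan hdim b
  have hc : (QuotientGroup.mk g : G ⧸ H) ≠ QuotientGroup.mk 1 := by
    intro h
    apply hgH
    have := QuotientGroup.eq.mp h.symm
    simpa using this
  have hle : ∀ t : G, W₀.toSubmodule.map (ρ t) ≤ Submodule.span k
      ((fun p : (G ⧸ H) × Fin n => ρ p.1.out (b p.2 : V)) ''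
        ({(QuotientGroup.mk t : G ⧸ H)} ×ˢ Set.univ)) := by
    intro t
    rw [map_toSubmodule_eq_map_out ρ H W₀ t]
    rintro _ ⟨w, hw, rfl⟩
    have hw' : w = ∑ s, b.repr ⟨w, hw⟩ s • (b s : V) := by
      simpa only [Submodule.coe_sum, Submodule.coe_smul] using
        congrArg Subtype.val (b.sum_repr ⟨w, hw⟩).symm
    rw [hw', map_sum]
    refine Submodule.sum_mem _ fun s _ => ?_
    rw [map_smul]
    exact Submodule.smul_mem _ _
      (Submodule.subset_span ⟨(QuotientGroup.mk t, s), ⟨rfl, trivial⟩, rfl⟩)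
  have hdisj := hli.disjoint_span_image
    (s := {(QuotientGroup.mk 1 : G ⧸ H)} ×ˢ Set.univ)
    (t := {(QuotientGroup.mk g : G ⧸ H)} ×ˢ Set.univ)
    (by rw [Set.disjoint_prod, Set.disjoint_singleton]; exact Or.inl hc.symm)
  have h1 := hle 1
  rw [map_one, Module.End.one_eq_id, Submodule.map_id] at h1
  have h2 := hle g
  rw [hg] at h2
  exact hW₀ (le_bot_iff.mp (le_trans (le_inf h1 h2) hdisj.le_bot))

/-- The kernel of an induced representation with `W₀ ≠ 0` is contained in `H`.
[cite: SerreLinearRepresentations1977, §3.3] -/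
theorem mem_of_apply_eq_one [H.FiniteIndex]
    (hspan : ⨆ g : G, W₀.toSubmodule.map (ρ g) = ⊤)
    (hdim : Module.finrank k V = H.index * Module.finrank k W₀.toSubmodule)
    (hW₀ : W₀.toSubmodule ≠ ⊥) {g : G} (hg : ρ g = 1) : g ∈ H :=
  mem_of_map_toSubmodule_eq ρ H W₀ hspan hdim hW₀
    (by rw [hg, Module.End.one_eq_id, Submodule.map_id])

end Stabiliser

/-! ### The main theorem for a group acting through a finite quotient -/

section MainQuotient

variable {k : Type*} [Field k] [CharZero k] {G : Type*} [Group G]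
  {V : Type*} [AddCommGroup V] [Module k V] [FiniteDimensional k V]
  (ρ : Representation k G V) (H : Subgroup G) (W₀ : Subrepresentation (ρ.comp H.subtype))
  {D I : Subgroup G} {φ : G} {ι : Type*} [Fintype ι] (τ : ι → G) (f : ι → ℕ) (φ' : ι → G)
  (N : Subgroup G) [N.Normal] [N.FiniteIndex]

/-- **Artin's theorem on the Euler factor of an induced representation, profinite form.**
Same statement as `reverse_charpoly_restrict_invariants_eq_prod`, for an arbitrary group `G`
acting through a finite quotient `G/N` (`N ⊴ G` of finite index acting trivially, `N ≤ H`),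
with `D/I` generated by `φ` *modulo `N`* (`hgen`: every `d ∈ D` lies in `φ^a I N`) — the form
in which it applies to absolute Galois groups, where `D_𝔓/I_𝔓 ≅ Ẑ` is only topologically
generated by the Frobenius.  Proof: apply the finite-group theorem to `G/N`.
[cite: NeukirchANT1999, VII (10.4) (iv), proof pp. 523–524] [cite: ArtinHamburg1931, §2] -/
theorem reverse_charpoly_restrict_invariants_eq_prod_of_quotient
    (hNρ : ∀ n ∈ N, ρ n = 1) (hNH : N ≤ H)
    (hspan : ⨆ g : G, W₀.toSubmodule.map (ρ g) = ⊤)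
    (hdim : Module.finrank k V = H.index * Module.finrank k W₀.toSubmodule)
    (hID : I ≤ D) (hIn : ∀ d ∈ D, ∀ y ∈ I, d⁻¹ * y * d ∈ I) (hφ : φ ∈ D)
    (hgen : ∀ d ∈ D, ∃ a : ℕ, ∃ y ∈ I, (φ ^ a * y)⁻¹ * d ∈ N)
    (h1 : ∀ x : G, ∃ i, ∃ d ∈ D, ∃ h ∈ H, x = d * τ i * h)
    (h2 : ∀ i j, (∃ d ∈ D, ∃ h ∈ H, τ j = d * τ i * h) → i = j)
    (hφ'H : ∀ i, φ' i ∈ H) (hφ'I : ∀ i, ∃ y ∈ I, φ' i = (τ i)⁻¹ * (φ ^ f i * y * τ i))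
    (hf : ∀ i (m : ℕ), (∃ y ∈ I, (τ i)⁻¹ * (φ ^ m * y * τ i) ∈ H) → f i ∣ m)
    (hA : Set.MapsTo (ρ φ) ↑(Representation.invariants (ρ.comp I.subtype))
      ↑(Representation.invariants (ρ.comp I.subtype)))
    (hB : ∀ i, Set.MapsTo (ρ (φ' i))
      ↑(W₀.toSubmodule ⊓ Representation.invariants
        (ρ.comp (H ⊓ I.comap (MulAut.conj (τ i)).toMonoidHom).subtype))
      ↑(W₀.toSubmodule ⊓ Representation.invariants
        (ρ.comp (H ⊓ I.comap (MulAut.conj (τ i)).toMonoidHom).subtype))) :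
    ((ρ φ).restrict hA).charpoly.reverse =
      ∏ i, Polynomial.expand k (f i) ((ρ (φ' i)).restrict (hB i)).charpoly.reverse := by
  -- pass to the finite quotient `Ḡ = G ⧸ N`
  set mk := QuotientGroup.mk' N with hmk
  set ρ' : Representation k (G ⧸ N) V := QuotientGroup.lift N ρ fun n hn => hNρ n hn with hρ'
  have hρ'mk : ∀ g, ρ' (mk g) = ρ g := fun g => rfl
  set H' := H.map mk with hH'
  set D' := D.map mk with hD'
  set I' := I.map mk with hI'
  let W₀' : Subrepresentation (ρ'.comp H'.subtype) :=
    { toSubmodule := W₀.toSubmodule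
      apply_mem_toSubmodule := by
        rintro ⟨z, hz⟩ v hv
        obtain ⟨h, hh, rfl⟩ := Subgroup.mem_map.mp hz
        exact W₀.apply_mem_toSubmodule ⟨h, hh⟩ hv }
  -- the hypotheses in `G ⧸ N`
  have hspan' : ⨆ g : G ⧸ N, W₀'.toSubmodule.map (ρ' g) = ⊤ := by
    rw [eq_top_iff, ← hspan, iSup_le_iff]
    intro g
    exact le_iSup_of_le (mk g) le_rfl
  have hindex : H'.index = H.index := by
    rw [← Subgroup.index_comap_of_surjective H' (QuotientGroup.mk'_surjective N), hH',
      Subgroup.comap_map_eq_self]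
    rw [QuotientGroup.ker_mk']
    exact hNH
  have hdim' : Module.finrank k V = H'.index * Module.finrank k W₀'.toSubmodule := by
    rw [hindex]; exact hdim
  have hID' : I' ≤ D' := Subgroup.map_mono hID
  have hIn' : ∀ d ∈ D', ∀ y ∈ I', d⁻¹ * y * d ∈ I' := by
    intro d hd y hy
    obtain ⟨d₀, hd₀, rfl⟩ := Subgroup.mem_map.mp hd
    obtain ⟨y₀, hy₀, rfl⟩ := Subgroup.mem_map.mp hy
    rw [← map_inv, ← map_mul, ← map_mul]
    exact Subgroup.mem_map_of_mem _ (hIn d₀ hd₀ y₀ hy₀)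
  have hφD' : mk φ ∈ D' := Subgroup.mem_map_of_mem _ hφ
  have hgen' : ∀ d ∈ D', ∃ a : ℕ, ∃ y ∈ I', d = mk φ ^ a * y := by
    intro d hd
    obtain ⟨d₀, hd₀, rfl⟩ := Subgroup.mem_map.mp hd
    obtain ⟨a, y, hy, hn⟩ := hgen d₀ hd₀
    refine ⟨a, mk y, Subgroup.mem_map_of_mem _ hy, ?_⟩
    rw [← map_pow, ← map_mul]
    exact (QuotientGroup.eq.mpr hn).symm
  have h1' : ∀ x : G ⧸ N, ∃ i, ∃ d ∈ D', ∃ h ∈ H', x = d * mk (τ i) * h := by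
    intro x
    induction x using QuotientGroup.induction_on with
    | H x =>
      obtain ⟨i, d, hd, h, hh, rfl⟩ := h1 x
      exact ⟨i, mk d, Subgroup.mem_map_of_mem _ hd, mk h, Subgroup.mem_map_of_mem _ hh, by
        rw [← map_mul, ← map_mul]; rfl⟩
  have h2' : ∀ i j, (∃ d ∈ D', ∃ h ∈ H', mk (τ j) = d * mk (τ i) * h) → i = j := by
    rintro i j ⟨d, hd, h, hh, hEq⟩
    obtain ⟨d₀, hd₀, rfl⟩ := Subgroup.mem_map.mp hd
    obtain ⟨h₀, hh₀, rfl⟩ := Subgroup.mem_map.mp hh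
    rw [← map_mul, ← map_mul] at hEq
    have hn : (τ j)⁻¹ * (d₀ * τ i * h₀) ∈ N := QuotientGroup.eq.mp hEq
    refine h2 i j ⟨d₀, hd₀, h₀ * ((τ j)⁻¹ * (d₀ * τ i * h₀))⁻¹,
      H.mul_mem hh₀ (H.inv_mem (hNH hn)), by group⟩
  have hφ'H' : ∀ i, mk (φ' i) ∈ H' := fun i => Subgroup.mem_map_of_mem _ (hφ'H i)
  have hφ'I' : ∀ i, ∃ y ∈ I', mk (φ' i) = (mk (τ i))⁻¹ * (mk φ ^ f i * y * mk (τ i)) := by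
    intro i
    obtain ⟨y, hy, hEq⟩ := hφ'I i
    refine ⟨mk y, Subgroup.mem_map_of_mem _ hy, ?_⟩
    rw [hEq]
    simp only [map_mul, map_inv, map_pow]
  have hf' : ∀ i (m : ℕ), (∃ y ∈ I', (mk (τ i))⁻¹ * (mk φ ^ m * y * mk (τ i)) ∈ H') →
      f i ∣ m := by
    rintro i m ⟨y, hy, hmem⟩
    obtain ⟨y₀, hy₀, rfl⟩ := Subgroup.mem_map.mp hy
    rw [← map_pow, ← map_mul, ← map_mul, ← map_inv, ← map_mul] at hmem
    obtain ⟨h₀, hh₀, hEq⟩ := Subgroup.mem_map.mp hmem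
    have hn : h₀⁻¹ * ((τ i)⁻¹ * (φ ^ m * y₀ * τ i)) ∈ N := QuotientGroup.eq.mp hEq
    refine hf i m ⟨y₀, hy₀, ?_⟩
    have := H.mul_mem hh₀ (hNH hn)
    rwa [mul_inv_cancel_left] at this
  -- invariants agree
  have hinvI := invariants_comp_map_mk_eq ρ N hNρ I
  have hinvJ := fun i => invariants_comp_inf_comap_map_mk_eq ρ N hNρ H I hNH (τ i)
  have hA' : Set.MapsTo (ρ' (mk φ)) ↑(Representation.invariants (ρ'.comp I'.subtype))
      ↑(Representation.invariants (ρ'.comp I'.subtype)) := by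
    rw [hI', hρ', hmk, hinvI]; exact hA
  have hB' : ∀ i, Set.MapsTo (ρ' (mk (φ' i)))
      ↑(W₀'.toSubmodule ⊓ Representation.invariants
        (ρ'.comp (H' ⊓ I'.comap (MulAut.conj (mk (τ i))).toMonoidHom).subtype))
      ↑(W₀'.toSubmodule ⊓ Representation.invariants
        (ρ'.comp (H' ⊓ I'.comap (MulAut.conj (mk (τ i))).toMonoidHom).subtype)) := by
    intro i v hv
    obtain ⟨hv1, hv2⟩ := hv
    have hv2' : v ∈ Representation.invariants
        (ρ.comp (H ⊓ I.comap (MulAut.conj (τ i)).toMonoidHom).subtype) := by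
      rw [← hinvJ i]; exact hv2
    obtain ⟨hw1, hw2⟩ := hB i ⟨hv1, hv2'⟩
    refine ⟨hw1, ?_⟩
    rw [← hinvJ i] at hw2
    exact hw2
  -- the finite-group theorem in `G ⧸ N`
  have main := reverse_charpoly_restrict_invariants_eq_prod ρ' H' W₀' (fun i => mk (τ i)) f
    (fun i => mk (φ' i)) hspan' hdim' hID' hIn' hφD' hgen' h1' h2' hφ'H' hφ'I' hf' hA' hB'
  have e1 : ((ρ' (mk φ)).restrict hA').charpoly = ((ρ φ).restrict hA).charpoly :=
    charpoly_restrict_congr hinvI (hρ'mk φ) _ _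
  have e2 : ∀ i, ((ρ' (mk (φ' i))).restrict (hB' i)).charpoly =
      ((ρ (φ' i)).restrict (hB i)).charpoly := fun i =>
    charpoly_restrict_congr (congrArg (W₀.toSubmodule ⊓ ·) (hinvJ i)) (hρ'mk _) _ _
  rw [e1] at main
  rw [main]
  exact Finset.prod_congr rfl fun i _ => by rw [e2 i]

end MainQuotient

end Literature.RepresentationTheory.FiniteGroups
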